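import Literature.AlgebraicGeometry.Morphisms.DevissageClass
import HarnessLib

/-!
# Restriction of coherent modules along open immersions

For an open immersion `f : X → Y` and a sheaf of `𝒪_Y`-modules `M`, Mathlib's restriction
`M.restrict f = M|_X` (`Scheme.Modules.restrict`) has sections `Γ(U, M|_X) = Γ(f(U), M)`
(definitional) with `Γ(U, 𝒪_X)` acting through `Γ(U, 𝒪_X) ≅ Γ(f(U), 𝒪_Y)` (`Scheme.Hom.appIso`).
We prove that the two halves of the affine-local coherence predicate `Coh` of
`Morphisms/DevissageClass` (`IsAffineLocalizing` = EGA I 1.4.1 d1), d2), Hartshorne II Lemma 5.3;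
`IsAffineFiniteType`, Hartshorne II Prop. 5.4) pass to `M|_X`: an affine open `V ⊆ X` has affine
image `f(V)` (`IsAffineOpen.image_of_isOpenImmersion`) and `f(D(r)) = D(r')` for the function `r'`
corresponding to `r` (`Scheme.image_basicOpen`), so numerators, torsion and finite generation for
`M|_X` on `V` are those of `M` on `f(V)` (Hartshorne II Prop. 5.4 / Cor. 5.5: quasi-coherence and
coherence are local, in particular stable under restriction to open subschemes).

* `isAffineLocalizing_restrict`, `isAffineFiniteType_restrict`, `coh_restrict`.

Everything is proved; no named facts. Mathlib searched (pin v4.32): `Scheme.Modules.restrict`,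
`Scheme.Modules.restrict_map`, `Scheme.Hom.appIso_inv_naturality`, `Scheme.image_basicOpen`,
`IsAffineOpen.image_of_isOpenImmersion`, `Module.Finite.trans` (used); Mathlib has no coherence
predicate for `Scheme.Modules`.

## References

* R. Hartshorne, *Algebraic Geometry*, GTM 52, Springer (1977): II Lemma 5.3 (p. 112), II Prop. 5.4
  and Cor. 5.5 (pp. 113–114). [Hartshorne1977]
* A. Grothendieck, J. Dieudonné, *Éléments de géométrie algébrique I* (Springer, 1971), Thm. 1.4.1,
  conditions d1), d2). [folklore]
-/

noncomputable section

-- `TopCat.Presheaf`/`TopCat.Sheaf` are not reducible (as in Mathlib's `AlgebraicGeometry/Modules`).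
set_option backward.isDefEq.respectTransparency false

open CategoryTheory AlgebraicGeometry TopologicalSpace Opposite
open Literature.AlgebraicGeometry.Morphisms

universe u

namespace Literature.AlgebraicGeometry.Modules

variable {X Y : Scheme.{u}} (f : X ⟶ Y) [IsOpenImmersion f] (M : Y.Modules)

/-- The scalar action on `Γ(U, M|_X) = Γ(f(U), M)`: `r • x = r' • x` with `r' ∈ Γ(f(U), 𝒪_Y)`
corresponding to `r` under `Γ(U, 𝒪_X) ≅ Γ(f(U), 𝒪_Y)`. [folklore] -/
theorem restrict_smul (U : X.Opens) (r : Γ(X, U)) (x : Γ(M.restrict f, U)) :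
    r • x = ((f.appIso U).inv r • (show Γ(M, f ''ᵁ U) from x) : Γ(M, f ''ᵁ U)) := rfl

/-- The restriction maps of `M|_X` are those of `M`. [folklore] -/
theorem restrict_map_apply {U V : X.Opens} (i : U ⟶ V) (x : Γ(M.restrict f, V)) :
    (M.restrict f).presheaf.map i.op x =
      (M.presheaf.map (f.opensFunctor.map i).op (show Γ(M, f ''ᵁ V) from x) : Γ(M, f ''ᵁ U)) :=
  rfl

/-- Transport of functions: `(r|_U)' = r'|_{f(U)}`. [folklore] -/
theorem appIso_inv_map {U V : X.Opens} (i : U ⟶ V) (r : Γ(X, V)) :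
    (f.appIso U).inv (X.presheaf.map i.op r) =
      Y.presheaf.map (f.opensFunctor.map i).op ((f.appIso V).inv r) :=
  ConcreteCategory.congr_hom (f.appIso_inv_naturality i.op) r

/-- **`M|_X` is affine-localizing when `M` is** (numerators and torsion on an affine `V ⊆ X` are
those of `M` on the affine `f(V)`, as `f(D(r)) = D(r')`).
[cite: Hartshorne1977, II Lemma 5.3 (p. 112) and Prop. 5.4 (p. 113)] -/
theorem isAffineLocalizing_restrict (hM : IsAffineLocalizing M) : IsAffineLocalizing (M.restrict f) := by
  constructor
  · intro V hV r W hW s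
    have hWV : W ≤ V := hW.trans_le (X.basicOpen_le r)
    have eW : f ''ᵁ W = Y.basicOpen ((f.appIso V).inv r) := by rw [hW, Scheme.image_basicOpen]
    obtain ⟨n, x, hx⟩ := hM.numerator (hV.image_of_isOpenImmersion f) ((f.appIso V).inv r) eW s
    refine ⟨n, x, ?_⟩
    rw [restrict_map_apply, restrict_smul, map_pow, appIso_inv_map]
    refine (congrArg (fun φ => M.presheaf.map φ x) (Subsingleton.elim _ _)).trans (hx.trans ?_)
    exact congrArg (fun φ => Y.presheaf.map φ ((f.appIso V).inv r) ^ n • (show Γ(M, f ''ᵁ W) from s))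
      (Subsingleton.elim _ _)
  · intro V hV r x W hWV hrW hx
    have hD : Y.basicOpen ((f.appIso V).inv r) ≤ f ''ᵁ W := by
      rw [← Scheme.image_basicOpen]; exact f.image_mono hrW
    rw [restrict_map_apply] at hx
    obtain ⟨n, hn⟩ := hM.torsion (hV.image_of_isOpenImmersion f) ((f.appIso V).inv r)
      (show Γ(M, f ''ᵁ V) from x) (f.image_mono hWV) hD
      ((congrArg (fun φ => M.presheaf.map φ (show Γ(M, f ''ᵁ V) from x))
        (Subsingleton.elim _ _)).trans hx)
    refine ⟨n, ?_⟩
    rw [restrict_smul, map_pow]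
    exact hn

/-- **`M|_X` is of affine-finite type when `M` is**: `Γ(V, M|_X) = Γ(f(V), M)` is finite over
`Γ(f(V), 𝒪_Y) ≅ Γ(V, 𝒪_X)`. [cite: Hartshorne1977, II Prop. 5.4 (p. 113)] -/
theorem isAffineFiniteType_restrict (hM : IsAffineFiniteType M) : IsAffineFiniteType (M.restrict f) := by
  intro V hV
  haveI : Module.Finite Γ(Y, f ''ᵁ V) Γ(M, f ''ᵁ V) := hM (hV.image_of_isOpenImmersion f)
  letI : Algebra Γ(X, V) Γ(Y, f ''ᵁ V) := (f.appIso V).inv.hom.toAlgebra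
  haveI : Module.Finite Γ(X, V) Γ(Y, f ''ᵁ V) :=
    Module.Finite.of_surjective (Algebra.linearMap Γ(X, V) Γ(Y, f ''ᵁ V))
      (ConcreteCategory.bijective_of_isIso (f.appIso V).inv).2
  letI : Module Γ(X, V) Γ(M, f ''ᵁ V) := Module.compHom Γ(M, f ''ᵁ V) (f.appIso V).inv.hom
  haveI : IsScalarTower Γ(X, V) Γ(Y, f ''ᵁ V) Γ(M, f ''ᵁ V) :=
    ⟨fun t a m => mul_smul ((f.appIso V).inv t) a m⟩
  have h : Module.Finite Γ(X, V) Γ(M, f ''ᵁ V) := Module.Finite.trans Γ(Y, f ''ᵁ V) Γ(M, f ''ᵁ V)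
  exact h

/-- **`M|_X` is coherent when `M` is** (coherence is local).
[cite: Hartshorne1977, II Prop. 5.4 and Cor. 5.5 (pp. 113–114)] -/
theorem coh_restrict (hM : Coh M) : Coh (M.restrict f) :=
  ⟨isAffineLocalizing_restrict f M hM.loc, isAffineFiniteType_restrict f M hM.ft⟩

end Literature.AlgebraicGeometry.Modules

end
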